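import Literature.AlgebraicGeometry.Motives.AbelianVarietyImageSimpleProofs
import Literature.AlgebraicGeometry.Motives.AbelianVarietyImageRestrict
import HarnessLib

/-!
# Schur's lemma for abelian varieties with operators: equivariant homomorphisms into `R`-simple ones

The tree's `Motives/AbelianVarietyImageSimpleProofs` proves, for SIMPLE abelian varieties, that a
non-zero homomorphism `f : X ⟶ Y` to a simple `Y` is surjective and that non-zero endomorphisms of
a simple abelian variety are isogenies (Mumford §19 Cor. 2 of Thm. 1).  Here the same WITH
OPERATORS: `X`, `Y` carry actions `φ : R →+* End X`, `ψ : R →+* End Y` of a semiring `R`, `f` is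
EQUIVARIANT (`φ r ≫ f = f ≫ ψ r`), and `Y` is only assumed **`R`-simple** (no abelian variety `W`
with `R`-action `ω` and `ω`/`ψ`-equivariant closed immersion `W ↪ Y` of dimension
`0 < dim W < dim Y`; the predicate is written out, binders explicit).  The image `im f ↪ Y`
carries the induced action `imageAction` (`Motives/AbelianVarietyImageRestrict`) making `im f ↪ Y`
equivariant, so it is an `R`-stable abelian subvariety and the proofs of the simple case go through:

* `AbelianVariety.surjective_of_simpleFor` — a non-zero equivariant homomorphism to an
  `R`-simple abelian variety is surjective;
* `AbelianVariety.dim_le_of_simpleFor_of_ne_zero` — hence `dim Y ≤ dim X`;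
* `AbelianVariety.isIsogeny_of_simpleFor_of_ne_zero_end` — **a non-zero equivariant endomorphism
  of an `R`-simple abelian variety is an isogeny** (so the commutant of `R` in `End⁰ X` is a
  division algebra — Schur's lemma);
* `AbelianVariety.isIsogeny_of_simpleFor_of_ne_zero_of_dim_eq`,
  `AbelianVariety.isIsogeny_of_simpleFor_of_ne_zero_of_ne_zero` — a non-zero equivariant
  homomorphism between `R`-simple abelian varieties of the same dimension, resp. admitting a
  non-zero equivariant homomorphism back, is an isogeny.

(Lange–Rodríguez §2.9 uses exactly these for `G`-simple abelian subvarieties of a `G`-Jacobian;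
for `R` an order of a CM field they are the Schur lemma of the isogeny category of abelian
varieties with complex multiplication.)  Everything is proved; no definition, no named fact
(D-0026).

## References

* D. Mumford, *Abelian Varieties* (1970), §19 Thm. 1 and Cor. 2 (pp. 173–174). [MumfordAV1970]
* H. Lange, R. E. Rodríguez, *Decomposition of Jacobians by Prym Varieties*, LNM 2310 (2022),
  §2.7 Thm. 2.7.1 and §2.9. [LangeRodriguez2022]
-/

noncomputable section

universe u v

open CategoryTheory CategoryTheory.Limits AlgebraicGeometry

namespace Literature.AlgebraicGeometry.Motives

namespace AbelianVariety

variable {K : Type u} [Field K] {R : Type v} [Semiring R] {X Y : AbelianVariety K}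

/-- **A non-zero equivariant homomorphism to an `R`-simple abelian variety is surjective**: its
image `im f ↪ Y` is an `R`-stable abelian subvariety (`imageAction`) of positive dimension, hence
all of `Y`. [cite: MumfordAV1970, §19 Cor. 2 of Thm. 1 (proof)] [cite: LangeRodriguez2022, §2.9] -/
theorem surjective_of_simpleFor (φ : R →+* End X) (ψ : R →+* End Y) (f : X ⟶ Y)
    (hf : ∀ r : R, End.asHom (φ r) ≫ f = f ≫ End.asHom (ψ r))
    (hY : ∀ (W : AbelianVariety K) (ω : R →+* End W) (w : W ⟶ Y),
      IsClosedImmersion (Hom.toSchemeHom w) →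
      (∀ r : R, w ≫ End.asHom (ψ r) = End.asHom (ω r) ≫ w) → 0 < W.dim → W.dim < Y.dim → False)
    (hf0 : f ≠ 0) : Surjective (Hom.toSchemeHom f) := by
  by_contra hns
  have hns' : ¬ Function.Surjective (Hom.toSchemeHom (imageι f)) := fun h => hns ⟨by
    rw [← toImage_imageι f]
    change Function.Surjective ((Hom.toSchemeHom (toImage f)) ≫ Hom.toSchemeHom (imageι f))
    rw [Scheme.Hom.comp_base]
    exact h.comp (surjective_toSchemeHom_toImage f).1⟩
  exact hY (image f) (imageAction f φ ψ hf) (imageι f) (isClosedImmersion_toSchemeHom_imageι f)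
    (fun r ↦ (imageAction_ι f φ ψ hf r).symm) (dim_image_pos f hf0)
    (dim_lt_of_isClosedImmersion_of_not_surjective (imageι f) hns')

/-- A non-zero equivariant homomorphism to an `R`-simple abelian variety lowers dimension:
`dim Y ≤ dim X`. [cite: MumfordAV1970, §19 Cor. 2 of Thm. 1] -/
theorem dim_le_of_simpleFor_of_ne_zero (φ : R →+* End X) (ψ : R →+* End Y) (f : X ⟶ Y)
    (hf : ∀ r : R, End.asHom (φ r) ≫ f = f ≫ End.asHom (ψ r))
    (hY : ∀ (W : AbelianVariety K) (ω : R →+* End W) (w : W ⟶ Y),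
      IsClosedImmersion (Hom.toSchemeHom w) →
      (∀ r : R, w ≫ End.asHom (ψ r) = End.asHom (ω r) ≫ w) → 0 < W.dim → W.dim < Y.dim → False)
    (hf0 : f ≠ 0) : Y.dim ≤ X.dim := by
  haveI := surjective_of_simpleFor φ ψ f hf hY hf0
  have h := Literature.AlgebraicGeometry.Motives.Scheme.topologicalKrullDim_le_of_universallyClosed_of_surjective
    (Hom.toSchemeHom f)
  rw [topologicalKrullDim_left, topologicalKrullDim_left] at h
  exact_mod_cast h

/-- **Schur's lemma with operators: a non-zero equivariant endomorphism of an `R`-simple abelian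
variety is an isogeny** (it is surjective, `surjective_of_simpleFor`, hence an isogeny by the
dimension formula). Consequently the commutant of `R` in `End⁰ X` is a division algebra.
[cite: MumfordAV1970, §19 Cor. 2 of Thm. 1] [cite: LangeRodriguez2022, §2.9] -/
theorem isIsogeny_of_simpleFor_of_ne_zero_end (φ : R →+* End X)
    (hX : ∀ (W : AbelianVariety K) (ω : R →+* End W) (w : W ⟶ X),
      IsClosedImmersion (Hom.toSchemeHom w) →
      (∀ r : R, w ≫ End.asHom (φ r) = End.asHom (ω r) ≫ w) → 0 < W.dim → W.dim < X.dim → False)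
    (g : X ⟶ X) (hg : ∀ r : R, End.asHom (φ r) ≫ g = g ≫ End.asHom (φ r)) (hg0 : g ≠ 0) :
    IsIsogeny g := by
  haveI := surjective_of_simpleFor φ φ g hg hX hg0
  exact isIsogeny_of_surjective_end g

/-- A non-zero equivariant homomorphism to an `R`-simple abelian variety of the same dimension is
an isogeny. [cite: MumfordAV1970, §19 Cor. 2 of Thm. 1] -/
theorem isIsogeny_of_simpleFor_of_ne_zero_of_dim_eq (φ : R →+* End X) (ψ : R →+* End Y)
    (f : X ⟶ Y) (hf : ∀ r : R, End.asHom (φ r) ≫ f = f ≫ End.asHom (ψ r))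
    (hY : ∀ (W : AbelianVariety K) (ω : R →+* End W) (w : W ⟶ Y),
      IsClosedImmersion (Hom.toSchemeHom w) →
      (∀ r : R, w ≫ End.asHom (ψ r) = End.asHom (ω r) ≫ w) → 0 < W.dim → W.dim < Y.dim → False)
    (hf0 : f ≠ 0) (h : X.dim = Y.dim) : IsIsogeny f := by
  haveI := surjective_of_simpleFor φ ψ f hf hY hf0
  exact isIsogeny_of_surjective_of_dim_eq f h

/-- **Non-zero equivariant homomorphisms between `R`-simple abelian varieties admitting a non-zero
equivariant homomorphism back are isogenies** (both are surjective, so the dimensions agree).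
[cite: MumfordAV1970, §19 Cor. 2 of Thm. 1] [cite: LangeRodriguez2022, §2.9] -/
theorem isIsogeny_of_simpleFor_of_ne_zero_of_ne_zero (φ : R →+* End X) (ψ : R →+* End Y)
    (f : X ⟶ Y) (hf : ∀ r : R, End.asHom (φ r) ≫ f = f ≫ End.asHom (ψ r))
    (hX : ∀ (W : AbelianVariety K) (ω : R →+* End W) (w : W ⟶ X),
      IsClosedImmersion (Hom.toSchemeHom w) →
      (∀ r : R, w ≫ End.asHom (φ r) = End.asHom (ω r) ≫ w) → 0 < W.dim → W.dim < X.dim → False)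
    (hY : ∀ (W : AbelianVariety K) (ω : R →+* End W) (w : W ⟶ Y),
      IsClosedImmersion (Hom.toSchemeHom w) →
      (∀ r : R, w ≫ End.asHom (ψ r) = End.asHom (ω r) ≫ w) → 0 < W.dim → W.dim < Y.dim → False)
    (hf0 : f ≠ 0) {g : Y ⟶ X} (hg : ∀ r : R, End.asHom (ψ r) ≫ g = g ≫ End.asHom (φ r))
    (hg0 : g ≠ 0) : IsIsogeny f :=
  isIsogeny_of_simpleFor_of_ne_zero_of_dim_eq φ ψ f hf hY hf0
    (le_antisymm (dim_le_of_simpleFor_of_ne_zero ψ φ g hg hX hg0)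
      (dim_le_of_simpleFor_of_ne_zero φ ψ f hf hY hf0))

end AbelianVariety

end Literature.AlgebraicGeometry.Motives

end
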